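import Literature.Analysis.FluidPDE.AncientSimilarityVorticity
import Literature.Analysis.FluidPDE.WholeSpaceIBP
import HarnessLib

/-!
# Whole-space integration by parts for localised quadratic (enstrophy-type) budgets

Analysis/FluidPDE support file (all results proved; companion of `WholeSpaceIBP.lean`; used by
the localised similarity-enstrophy estimate of the crux `MustSqueeze`, route SqueezeCycle,
NavierStokesRegularity). Boundary-free identities on a finite-dimensional inner product space
against a compactly supported smooth cutoff `φ`, for a smooth field `W` (e.g. a vorticity) and a
smooth transport field `X` (e.g. the Leray wind `y ↦ y` or a velocity):

* `integral_mul_inner_laplacian_self_eq` — `∫ φ ⟪ΔW, W⟫ = −∫ φ ‖∇W‖²_F + ½ ∫ ‖W‖² Δφ`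
  (Green's identity twice; Evans, *PDE*, App. C.2);
* `integral_mul_inner_convect_eq` — `2 ∫ φ ⟪(X·∇)W, W⟫ = −∫ (X·∇φ) ‖W‖² − ∫ (div X) φ ‖W‖²`
  (transport of `½‖W‖²`; Majda–Bertozzi §1.2), with the two instances `X = id` (`div = 3`) and
  `div X = 0`.

## References

* L. C. Evans, *Partial Differential Equations*, 2nd ed., AMS 2010, App. C.2 (Gauss–Green,
  Green's formulas). [Evans2010]
* A. J. Majda, A. L. Bertozzi, *Vorticity and Incompressible Flow*, CUP 2002, §1.2.
  [MajdaBertozziCUP2002]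
-/

noncomputable section

open MeasureTheory Set Function Filter InnerProductSpace
open _root_.Topology
open scoped RealInnerProductSpace Laplacian ContDiff BigOperators

namespace Literature.Analysis.FluidPDE

variable {E : Type*} [NormedAddCommGroup E] [InnerProductSpace ℝ E] [FiniteDimensional ℝ E]
  [MeasurableSpace E] [BorelSpace E]
variable {F' : Type*} [NormedAddCommGroup F'] [InnerProductSpace ℝ F']

omit [FiniteDimensional ℝ E] [MeasurableSpace E] [BorelSpace E] in
/-- Product rule for the cutoff: `∂ₕ(φ W) = (∂ₕφ) W + φ ∂ₕW`. [folklore] -/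
theorem fderiv_smul_apply_of_differentiableAt {φ : E → ℝ} {W : E → F'} {y : E} (hφ : DifferentiableAt ℝ φ y)
    (hW : DifferentiableAt ℝ W y) (h : E) :
    fderiv ℝ (fun z => φ z • W z) y h = fderiv ℝ φ y h • W y + φ y • fderiv ℝ W y h := by
  rw [fderiv_fun_smul hφ hW, add_comm]
  rfl

omit [FiniteDimensional ℝ E] [MeasurableSpace E] [BorelSpace E] in
/-- `∂ₕ ‖W‖² = 2 ⟪W, ∂ₕ W⟫`. [folklore] -/
theorem fderiv_norm_sq_apply_eq_two_mul_inner {W : E → F'} {y : E} (hW : DifferentiableAt ℝ W y) (h : E) :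
    fderiv ℝ (fun z => ‖W z‖ ^ 2) y h = 2 * ⟪W y, fderiv ℝ W y h⟫ := by
  have := (hW.hasFDerivAt.norm_sq).fderiv
  rw [this]
  simp only [FunLike.coe_smul, Pi.smul_apply, ContinuousLinearMap.comp_apply,
    innerSL_apply_apply, nsmul_eq_mul, Nat.cast_ofNat]

/-- **Green twice:** `∫ φ ⟪ΔW, W⟫ = −∫ φ ‖∇W‖²_F + ½ ∫ ‖W‖² Δφ` for `W ∈ C^∞` and a compactly
supported `φ ∈ C^∞` (Evans, *PDE*, App. C.2, Thm. 3 with empty boundary, applied to `(W, φW)`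
and to `(φ, ‖W‖²)`). [folklore] -/
theorem integral_mul_inner_laplacian_self_eq [FiniteDimensional ℝ F'] {φ : E → ℝ} {W : E → F'}
    (hφ : ContDiff ℝ ∞ φ)
    (hφc : HasCompactSupport φ) (hW : ContDiff ℝ ∞ W) :
    ∫ y, φ y * ⟪(Δ W) y, W y⟫ =
      -(∫ y, φ y * frobeniusNormSq (fderiv ℝ W y)) + (1 / 2) * ∫ y, ‖W y‖ ^ 2 * (Δ φ) y := by
  let b := stdOrthonormalBasis ℝ E
  have hW2 : ContDiff ℝ 2 W := hW.of_le (by norm_cast)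
  have hW1 : ContDiff ℝ 1 W := hW.of_le (by norm_cast)
  have hφ2 : ContDiff ℝ 2 φ := hφ.of_le (by norm_cast)
  have hφ1 : ContDiff ℝ 1 φ := hφ.of_le (by norm_cast)
  -- first Green identity, for `(W, φ • W)`
  have hφW1 : ContDiff ℝ 1 fun z => φ z • W z := hφ1.smul hW1
  have hφWc : HasCompactSupport fun z => φ z • W z := hφc.smul_right
  have g1 := integral_inner_laplacian_add_eq_zero b hW2 hφW1 (Or.inr hφWc)
  -- second Green identity, for `(φ, ‖W‖²)`
  have hN1 : ContDiff ℝ 1 fun z => ‖W z‖ ^ 2 := (hW1.norm_sq ℝ)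
  have g2 := integral_inner_laplacian_add_eq_zero b (F' := ℝ) hφ2 hN1 (Or.inl hφc)
  -- pointwise expansions
  have hdW : ∀ y, DifferentiableAt ℝ W y := fun y => hW1.differentiable one_ne_zero y
  have hdφ : ∀ y, DifferentiableAt ℝ φ y := fun y => hφ1.differentiable one_ne_zero y
  have e1 : ∀ y i, ⟪fderiv ℝ W y (b i), fderiv ℝ (fun z => φ z • W z) y (b i)⟫ =
      fderiv ℝ φ y (b i) * ⟪fderiv ℝ W y (b i), W y⟫ + φ y * ‖fderiv ℝ W y (b i)‖ ^ 2 := by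
    intro y i
    rw [fderiv_smul_apply_of_differentiableAt (hdφ y) (hdW y), inner_add_right, real_inner_smul_right,
      real_inner_smul_right, real_inner_self_eq_norm_sq]
  have e2 : ∀ y i, ⟪fderiv ℝ φ y (b i), fderiv ℝ (fun z => ‖W z‖ ^ 2) y (b i)⟫ =
      2 * (fderiv ℝ φ y (b i) * ⟪fderiv ℝ W y (b i), W y⟫) := by
    intro y i
    rw [fderiv_norm_sq_apply_eq_two_mul_inner (hdW y), real_inner_comm (W y), Real.inner_apply]
    ring
  -- integrability of the pieces (continuous, compactly supported through `φ` / `∇φ`)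
  have hcW : Continuous W := hW.continuous
  have hcDW : Continuous (fderiv ℝ W) := hW1.continuous_fderiv one_ne_zero
  have hcφ : Continuous φ := hφ.continuous
  have hcDφ : Continuous (fderiv ℝ φ) := hφ1.continuous_fderiv one_ne_zero
  have iA : ∀ i, Integrable (fun y => fderiv ℝ φ y (b i) * ⟪fderiv ℝ W y (b i), W y⟫) volume := by
    intro i
    refine ((hcDφ.clm_apply continuous_const).mul ((hcDW.clm_apply continuous_const).inner hcW))
      |>.integrable_of_hasCompactSupport ?_
    exact HasCompactSupport.intro hφc fun y hy => by simp [fderiv_of_notMem_tsupport ℝ hy]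
  have iB : ∀ i, Integrable (fun y => φ y * ‖fderiv ℝ W y (b i)‖ ^ 2) volume := fun i =>
    (hcφ.mul ((hcDW.clm_apply continuous_const).norm.pow 2)).integrable_of_hasCompactSupport
      hφc.mul_right
  -- rewrite `g1`
  have s1 : ∑ i, ∫ y, ⟪fderiv ℝ W y (b i), fderiv ℝ (fun z => φ z • W z) y (b i)⟫ =
      (∑ i, ∫ y, fderiv ℝ φ y (b i) * ⟪fderiv ℝ W y (b i), W y⟫) +
        ∫ y, φ y * frobeniusNormSq (fderiv ℝ W y) := by
    have : ∀ i, ∫ y, ⟪fderiv ℝ W y (b i), fderiv ℝ (fun z => φ z • W z) y (b i)⟫ =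
        (∫ y, fderiv ℝ φ y (b i) * ⟪fderiv ℝ W y (b i), W y⟫) + ∫ y, φ y * ‖fderiv ℝ W y (b i)‖ ^ 2 := by
      intro i
      rw [← integral_add (iA i) (iB i)]
      exact integral_congr_ae (Eventually.of_forall fun y => e1 y i)
    simp_rw [this, Finset.sum_add_distrib]
    congr 1
    rw [← integral_finsetSum _ fun i _ => iB i]
    refine integral_congr_ae (Eventually.of_forall fun y => ?_)
    show (∑ i, φ y * ‖fderiv ℝ W y (b i)‖ ^ 2) = φ y * frobeniusNormSq (fderiv ℝ W y)
    rw [frobeniusNormSq_eq_sum b, Finset.mul_sum]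
  have hL1 : ∫ y, ⟪(Δ W) y, φ y • W y⟫ = ∫ y, φ y * ⟪(Δ W) y, W y⟫ :=
    integral_congr_ae (Eventually.of_forall fun y => by simp only [real_inner_smul_right])
  rw [s1, hL1] at g1
  -- rewrite `g2`
  have s2 : ∑ i, ∫ y, ⟪fderiv ℝ φ y (b i), fderiv ℝ (fun z => ‖W z‖ ^ 2) y (b i)⟫ =
      2 * ∑ i, ∫ y, fderiv ℝ φ y (b i) * ⟪fderiv ℝ W y (b i), W y⟫ := by
    rw [Finset.mul_sum]
    refine Finset.sum_congr rfl fun i _ => ?_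
    rw [← integral_const_mul]
    exact integral_congr_ae (Eventually.of_forall fun y => e2 y i)
  have hL2 : ∫ y, ⟪(Δ φ) y, ‖W y‖ ^ 2⟫ = ∫ y, ‖W y‖ ^ 2 * (Δ φ) y :=
    integral_congr_ae (Eventually.of_forall fun y => by simp only [Real.inner_apply, mul_comm])
  rw [s2, hL2] at g2
  linarith

/-- **Transport of `½‖W‖²`:** `2 ∫ φ ⟪(X·∇)W, W⟫ + ∫ (X·∇φ) ‖W‖² + ∫ (div X) φ ‖W‖² = 0` for
`W, X ∈ C^∞` and a compactly supported `φ ∈ C^∞` (the trilinear convection identity applied to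
`(X, W, φW)`; Majda–Bertozzi §1.2). [folklore] -/
theorem two_mul_integral_mul_inner_convect_self_add_eq_zero {φ : E → ℝ} {W : E → F'} {X : E → E} (hφ : ContDiff ℝ ∞ φ)
    (hφc : HasCompactSupport φ) (hW : ContDiff ℝ ∞ W) (hX : ContDiff ℝ ∞ X) :
    2 * (∫ y, φ y * ⟪convect X W y, W y⟫) + (∫ y, fderiv ℝ φ y (X y) * ‖W y‖ ^ 2) +
      ∫ y, VectorCalculus.divergence X y * (φ y * ‖W y‖ ^ 2) = 0 := by
  have hW1 : ContDiff ℝ 1 W := hW.of_le (by norm_cast)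
  have hφ1 : ContDiff ℝ 1 φ := hφ.of_le (by norm_cast)
  have hX1 : ContDiff ℝ 1 X := hX.of_le (by norm_cast)
  have hφW1 : ContDiff ℝ 1 fun z => φ z • W z := hφ1.smul hW1
  have hφWc : HasCompactSupport fun z => φ z • W z := hφc.smul_right
  have key := integral_inner_convect_add_eq_zero hX1 hW1 hφW1 hφWc
  have hdW : ∀ y, DifferentiableAt ℝ W y := fun y => hW1.differentiable one_ne_zero y
  have hdφ : ∀ y, DifferentiableAt ℝ φ y := fun y => hφ1.differentiable one_ne_zero y
  -- pointwise
  have e1 : ∀ y, ⟪convect X W y, φ y • W y⟫ = φ y * ⟪convect X W y, W y⟫ := fun y => by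
    rw [real_inner_smul_right]
  have e2 : ∀ y, ⟪W y, convect X (fun z => φ z • W z) y⟫ =
      fderiv ℝ φ y (X y) * ‖W y‖ ^ 2 + φ y * ⟪convect X W y, W y⟫ := fun y => by
    rw [convect_apply, fderiv_smul_apply_of_differentiableAt (hdφ y) (hdW y), inner_add_right, real_inner_smul_right,
      real_inner_smul_right, real_inner_self_eq_norm_sq, convect_apply, real_inner_comm]
  have e3 : ∀ y, VectorCalculus.divergence X y * ⟪W y, φ y • W y⟫ =
      VectorCalculus.divergence X y * (φ y * ‖W y‖ ^ 2) := fun y => by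
    rw [real_inner_smul_right, real_inner_self_eq_norm_sq]
  -- integrability
  have hcW : Continuous W := hW.continuous
  have hcDW : Continuous (fderiv ℝ W) := hW1.continuous_fderiv one_ne_zero
  have hcφ : Continuous φ := hφ.continuous
  have hcDφ : Continuous (fderiv ℝ φ) := hφ1.continuous_fderiv one_ne_zero
  have hcX : Continuous X := hX.continuous
  have hconv : Continuous (convect X W) := by
    have : convect X W = fun y => fderiv ℝ W y (X y) := by funext y; rfl
    rw [this]; exact hcDW.clm_apply hcX
  have iP : Integrable (fun y => φ y * ⟪convect X W y, W y⟫) volume :=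
    (hcφ.mul (hconv.inner hcW)).integrable_of_hasCompactSupport hφc.mul_right
  have iT : Integrable (fun y => fderiv ℝ φ y (X y) * ‖W y‖ ^ 2) volume := by
    refine ((hcDφ.clm_apply hcX).mul (hcW.norm.pow 2)).integrable_of_hasCompactSupport ?_
    exact HasCompactSupport.intro hφc fun y hy => by simp [fderiv_of_notMem_tsupport ℝ hy]
  have s1 : ∫ y, ⟪convect X W y, φ y • W y⟫ = ∫ y, φ y * ⟪convect X W y, W y⟫ :=
    integral_congr_ae (Eventually.of_forall e1)
  have s2 : ∫ y, ⟪W y, convect X (fun z => φ z • W z) y⟫ =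
      (∫ y, fderiv ℝ φ y (X y) * ‖W y‖ ^ 2) + ∫ y, φ y * ⟪convect X W y, W y⟫ := by
    rw [← integral_add iT iP]
    exact integral_congr_ae (Eventually.of_forall e2)
  have s3 : ∫ y, VectorCalculus.divergence X y * ⟪W y, φ y • W y⟫ =
      ∫ y, VectorCalculus.divergence X y * (φ y * ‖W y‖ ^ 2) :=
    integral_congr_ae (Eventually.of_forall e3)
  rw [s1, s2, s3] at key
  linarith

omit [MeasurableSpace E] [BorelSpace E] in
/-- `div (y ↦ y) = dim E`. [folklore] -/
theorem divergence_fun_id_eq_finrank (y : E) :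
    VectorCalculus.divergence (fun z : E => z) y = (Module.finrank ℝ E : ℝ) := by
  rw [VectorCalculus.divergence]
  have : (fderiv ℝ (fun z : E => z) y : E →ₗ[ℝ] E) = LinearMap.id := by
    rw [show (fun z : E => z) = id from rfl, fderiv_id]; rfl
  rw [this, LinearMap.trace_id]

/-- **Leray drift:** `2 ∫ φ ⟪(y·∇)W, W⟫ = −∫ (y·∇φ) ‖W‖² − (dim E) ∫ φ ‖W‖²`. [folklore] -/
theorem two_mul_integral_mul_inner_fderiv_self_self_eq {φ : E → ℝ} {W : E → F'} (hφ : ContDiff ℝ ∞ φ)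
    (hφc : HasCompactSupport φ) (hW : ContDiff ℝ ∞ W) :
    2 * (∫ y, φ y * ⟪fderiv ℝ W y y, W y⟫) =
      -(∫ y, fderiv ℝ φ y y * ‖W y‖ ^ 2) - (Module.finrank ℝ E : ℝ) * ∫ y, φ y * ‖W y‖ ^ 2 := by
  have key := two_mul_integral_mul_inner_convect_self_add_eq_zero (X := fun z : E => z) hφ hφc hW contDiff_id
  simp only [convect_apply, divergence_fun_id_eq_finrank] at key
  rw [integral_const_mul] at key
  linarith

/-- **Incompressible transport:** `2 ∫ φ ⟪(V·∇)W, W⟫ = −∫ (V·∇φ) ‖W‖²` for `div V = 0`. [folklore] -/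
theorem two_mul_integral_mul_inner_convect_self_eq_of_isDivFree {φ : E → ℝ} {W : E → F'} {V : E → E}
    (hφ : ContDiff ℝ ∞ φ) (hφc : HasCompactSupport φ) (hW : ContDiff ℝ ∞ W) (hV : ContDiff ℝ ∞ V)
    (hdiv : VectorCalculus.IsDivFree V) :
    2 * (∫ y, φ y * ⟪convect V W y, W y⟫) = -(∫ y, fderiv ℝ φ y (V y) * ‖W y‖ ^ 2) := by
  have key := two_mul_integral_mul_inner_convect_self_add_eq_zero hφ hφc hW hV
  simp only [hdiv _, zero_mul, integral_zero, add_zero] at key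
  linarith

end Literature.Analysis.FluidPDE

end
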